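import Mathlib
import HarnessLib
import Summits.ValiantsHypothesis.ValiantsHypothesis.Theses.MonotoneRestoration
import Literature.Computability.AlgebraicComplexity.ArithCircuit
import Literature.Computability.AlgebraicComplexity.ArithCircuitProofs
import Literature.Computability.AlgebraicComplexity.MonotoneStructure
import Literature.Computability.AlgebraicComplexity.PermanentIrreducible
import Literature.ModelTheory.FiniteModelTheory.CkEquiv
import Summits.ValiantsHypothesis.ValiantsHypothesis.Theorems.MonotoneRestorationMonotoneRestorationQPCosetCount
import Summits.ValiantsHypothesis.ValiantsHypothesis.Theorems.MonotoneRestorationMonotoneRestorationQPSymmetricLB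
import Summits.ValiantsHypothesis.ValiantsHypothesis.Theorems.MonotoneRestorationMonotoneRestorationQPSupportSymmetrisation
import Summits.ValiantsHypothesis.ValiantsHypothesis.Theorems.MonotoneRestorationMonotoneRestorationQPSparseRegime
import Summits.ValiantsHypothesis.ValiantsHypothesis.Theorems.MonotoneRestorationMonotoneRestorationQPBeta
import Literature.Computability.AlgebraicComplexity.SymmetricArithCircuit
import Literature.Computability.AlgebraicComplexity.DawarWilsenach2025Proofs
import Literature.GroupTheory.PermutationGroups.SmallIndexSubgroups
import Summits.ValiantsHypothesis.ValiantsHypothesis.Theorems.MonotoneRestorationQP.Negative.LoadBearing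
import Summits.ValiantsHypothesis.ValiantsHypothesis.Theorems.MonotoneRestorationMonotoneRestorationQPPermSupportCount

/-! TTRL-lite variant V20194 of stmt-ValiantsHypothesis-15886

Bridge to `Multiset.esymm`: substituting the row sums `∑ j, X (i, j)` into the elementary symmetric
polynomial `esymm (Fin n) NNReal k` (via `bind₁ = aeval`) gives the `k`-th elementary symmetric
function of the multiset of row sums (`MvPolynomial.aeval_esymm_eq_multiset_esymm`). -/

namespace Summit.ValiantsHypothesis.ValiantsHypothesis.Theorems

open Summit.ValiantsHypothesis.ValiantsHypothesis.Theses.MonotoneRestoration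
open Literature.Computability.AlgebraicComplexity

/-- TTRL-lite variant V20194 of `stub_esymmRowSums_structure` (stmt-ValiantsHypothesis-15886):
`bind₁` of the row-sum substitution applied to `esymm (Fin n) NNReal k` is the `k`-th elementary
symmetric function `Multiset.esymm` of the multiset of row sums. This is
`MvPolynomial.aeval_esymm_eq_multiset_esymm` read through `bind₁ f = aeval f`. -/
theorem stub_esymmRowSums_structure_var20194 :
    ∀ (n k : ℕ), MvPolynomial.bind₁ (fun i : Fin n => ∑ j : Fin n, MvPolynomial.X (i, j))
      (MvPolynomial.esymm (Fin n) NNReal k) =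
      (Multiset.map (fun i : Fin n => ∑ j : Fin n,
        (MvPolynomial.X (i, j) : MvPolynomial (Fin n × Fin n) NNReal))
        (Finset.univ : Finset (Fin n)).val).esymm k := by
  intro n k
  rw [← MvPolynomial.aeval_eq_bind₁]
  exact MvPolynomial.aeval_esymm_eq_multiset_esymm (Fin n) NNReal k _

end Summit.ValiantsHypothesis.ValiantsHypothesis.Theorems
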